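import Summits.KontsevichZagierPeriods.Zeta5Search.RVFlatGaugeCap
import HarnessLib.Audit
import HarnessLib

/-!
# RVFlatGaugeLargeParam — the large-parameter class law (CV⁺), OBSERVED, and the REDUCTION of the flat `S₇`-gauge law to it (fam-rv gen 8, file 5)

HONEST FRAMING: systematic search; no irrationality claim unless certified.  This file MINTS ONE CONJECTURE NODE
(`LargeParamClassLaw`, tagged `@[conjecture]`, found by exact computation in this cell — it is NOT a published result and is
used below only as an explicit hypothesis `(h : LargeParamClassLaw)`), and PROVES a reduction theorem.  No γ / measure claim.

WHERE THIS SITS.  `RVFlatGaugeCap.lean` (THEOREM W⁺) proves the flat `S₇`-gauge law (Brown–Zudilin arXiv:2210.03391 (28)–(30)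
for all labellings; tree conjecture nodes `RVFlatGauge.FlatGaugeLaw` / `FlatGaugeLaw28`) on the COMPLETE reach of the route
"flat gauge ≤ class law (CV) ≤ truth" below `b₀ < 3p` with at most one long block, and records that on the rest of that region
(3,015 of 6,483 beyond-window instances at `b₀ ≤ 22`) the flat gauge EXCEEDS the class-law bound `cv = min(1,⌊d/p⌋) − N_p`,
so that no theorem of the (CV) shape can give FLAT there.  This file identifies, by exact computation, WHAT the truth does there.

THE OBSERVED LAW (CV⁺) (`LargeParamClassLaw`).  For `b` in the polytope, `b + e_j` in the polytope, `p ≥ 5` prime with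
`b₀ + 2 < p²`, at most one long block `b₀ − 2b_k ≥ p`, and `C_j(b) ≠ 0`:
    `v_p C_j(b) ≥ min(1,⌊d/p⌋) − N_p(b) + min( nbig , [LP] + [2p ≤ d] )`,                                    (CV⁺)
where `nbig = #{k : b_k ≥ p}`, and `[LP] = 1` iff some LARGE lower parameter is a PARTNER OF THE LONG SLOT in a large pair
form: there are slots `i ≠ k` with `b₀ − 2b_i ≥ p` (the long slot), `b_k ≥ p` and `b₀ − b_i − b_k ≥ p` (below `b₀ < 3p` the
first condition follows from the other two).  In words: beyond the class law, every large lower parameter can pay at most one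
extra unit, and the extra units on offer are one for a large partner and one for the second `p`-adic digit of `d`.  For
`nbig = 0` (CV⁺) IS the tree's PROVED class law (`ClusterValuation.casoratianLaw_of_noMultipole`); see
`largeParamClassLaw_of_small`.
EVIDENCE (exact rational arithmetic, gen-1 `dictionary.forms_dual` Casoratians; `pub-zeta5-fam-rv/gen8/rv8_excess.py`,
`rv8_cvplus.py`, outputs `out/excess_exh_*.json`, `out/cvplus_*.json`): 0 violations in all 18,038 deep instances
(`nbig ≥ 1`, `(b, j, p)` with `j` deduplicated by value) of the exhaustive range `b₀ ≤ 22` (13,656 with `b₀ < 3p`, 4,382 with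
`b₀ ≥ 3p`) and in a random sample of `23 ≤ b₀ ≤ 120` (51,429 deep instances, 0 violations, tight in 30,436 of the 31,019 with `b₀ < 3p`); TIGHT (equality) in 13,402 of the 13,656 and in 2,676 of
the 4,382; and on every one of the 87 invariant classes `(nbig, #pair forms ≥ p, #large partners, ⌊d/p⌋)` met at `b₀ ≤ 22`,
`b₀ < 3p`, the class minimum of `v_p C_j − cv` EQUALS the bonus `min(nbig, [LP] + [2p ≤ d])`.  The first version tried
(refund `⌊d/p⌋` uncapped for everybody) is FALSE on the window: 23,592 instances with `nbig = 0`, `⌊d/p⌋ = 2`, `v_p C_j = cv`.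

THE REDUCTION (PROVED here).  `gauge_le_cvplus`: for `c` in the polytope, `p ≥ 5`, at most one long block and `c₀ < 3p`,
    `−e_D♭(c,p) − v_p ρ(c) ≤ cv(c,p) + min(nbig, [LP] + [2p ≤ d])`
— the unit budget `Cap.flatBudget` closes in EVERY configuration once the bonus is on the right-hand side (the only new
combinatorial input is `Cap.nonESum_add_nden_le_six`: with a large partner present, non-`E` pair floors + large denominator
slots ≤ 6, again from the path structure `2–7–1–6–4–5–3` of the non-`E` pairs).  Hence
`flatGaugeLaw_of_largeParamClassLaw`: (CV⁺) ⇒ the flat `S₇`-gauge law for ALL `σ ∈ S₇` on the WHOLE region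
{at most one long block, `b₀ < 3p`, `p ≥ 5`} — i.e. (CV⁺) would close frontier (F1) of the gen-8 HANDOFF (the 3,015
beyond-window `(b, p)` pairs at `b₀ ≤ 22` with flat gauge `> cv`; 3,898 instances `(b, j, p)` in 31 classes), where moreover
the flat gauge is TIGHT (`v_p C_j` = the flat gauge bound in 3,768 of the 3,898; class minimum = gauge bound in 30 of the 31
classes): on (F1) the `S₇`-gauge law IS the sharp class law, so nothing weaker than (CV⁺) can prove it there.

VALUE (numbers, not adjectives).  γ: 0.000 (the record ray's deep primes lie in zone C, two long blocks).  Structural: the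
remaining one-long-block part of `FlatGaugeLaw` below `b₀ < 3p` is reduced to ONE class-law-shaped statement with an exact
tightness census — a target for the class-law provers (the `ClusterValuation` line), not for the gauge side.
-/

namespace Summit.KontsevichZagierPeriods.Zeta5Search.RVFlatGauge

open Finset
open Summit.KontsevichZagierPeriods.Zeta5Search.CasoratianValuation (casoratian shift InPolytope pairFloors refund)
open Summit.KontsevichZagierPeriods.Zeta5Search.WedgeDictionary (dOf Epairs)
open Summit.KontsevichZagierPeriods.Zeta5Search.SymmetricGauge
open Summit.KontsevichZagierPeriods.Zeta5Search.DualSeries (InBox)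
open Window

namespace Cap
/-! ### The bonus -/

/-- `[LP]`: `1` if some large lower parameter `c_{k+1} ≥ p` is a partner of a LONG slot `i ≠ k` (`c₀ − 2c_{i+1} ≥ p`) in a
large pair form `c₀ − c_{i+1} − c_{k+1} ≥ p`, else `0` (slots in `{0,…,6}`). -/
def lpUnit (c : ℕ → ℤ) (p : ℕ) : ℤ :=
  if ∃ i ∈ range 7, ∃ k ∈ range 7, i ≠ k ∧ (p : ℤ) ≤ c 0 - 2 * c (i + 1) ∧ (p : ℤ) ≤ c (k + 1) ∧
      (p : ℤ) ≤ c 0 - c (i + 1) - c (k + 1) then 1 else 0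

/-- The large-parameter bonus `min(nbig, [LP] + [2p ≤ d])`. -/
def lpBonus (c : ℕ → ℤ) (p : ℕ) : ℤ :=
  min (nbig c p : ℤ) (lpUnit c p + if 2 * (p : ℤ) ≤ dOf c then 1 else 0)

/-- `0 ≤ [LP] ≤ 1`. -/
theorem lpUnit_nonneg (c : ℕ → ℤ) (p : ℕ) : 0 ≤ lpUnit c p := by
  unfold lpUnit; split_ifs <;> norm_num

/-- `[LP] ≤ 1`. -/
theorem lpUnit_le_one (c : ℕ → ℤ) (p : ℕ) : lpUnit c p ≤ 1 := by
  unfold lpUnit; split_ifs <;> norm_num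

/-- `0 ≤ bonus`. -/
theorem lpBonus_nonneg (c : ℕ → ℤ) (p : ℕ) : 0 ≤ lpBonus c p := by
  unfold lpBonus
  have h1 := lpUnit_nonneg c p
  have h2 : (0 : ℤ) ≤ (if 2 * (p : ℤ) ≤ dOf c then 1 else 0) := by split_ifs <;> norm_num
  have h3 : (0 : ℤ) ≤ (nbig c p : ℤ) := Int.natCast_nonneg _
  exact le_min h3 (by linarith)

/-- With all seven lower parameters `< p` the bonus vanishes (`nbig = 0`). -/
theorem lpBonus_eq_zero_of_small {c : ℕ → ℤ} {p : ℕ} (hsmall : ∀ k ∈ range 7, c (k + 1) < p) : lpBonus c p = 0 := by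
  have h0 := lpBonus_nonneg c p
  have h1 : lpBonus c p ≤ (nbig c p : ℤ) := min_le_left _ _
  rw [nbig_eq_zero_of_small hsmall] at h1
  push_cast at h1
  linarith

/-! ### The one new combinatorial input -/

/-- Path check: a slot lies on at most two non-`E` pairs, and on two only if it is one of ρ's denominator slots
`{0,3,4,5,6}` (the interior vertices of the path `2–7–1–6–4–5–3`); so "non-`E` pairs through `i`" + "denominator slots
other than `i`" ≤ 6. -/
theorem path_six : ∀ i ∈ range 7,
    (nonE.filter fun x : ℕ × ℕ => x.1 = i ∨ x.2 = i).card + (denSlots.erase i).card ≤ 6 := by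
  decide

/-- **Large partner ⇒ non-`E` pair floors + large denominator slots ≤ 6.**  If some `c_{k+1} ≥ p` is a partner in a large
pair form `c₀ − c_{i₁+1} − c_{k+1} ≥ p` (with `c₀ < 3p` and at most one long block), then `i₁` is the long slot, `c_{i₁+1} < p`,
every non-`E` pair floor is `≤ 1` and vanishes off `i₁`, and `path_six` bounds the charge. -/
theorem nonESum_add_nden_le_six (c : ℕ → ℤ) {p : ℕ} (hc : InPolytope c) (hp : p.Prime) {i : ℕ}
    (hshort : ∀ k ∈ (range 7).erase i, c 0 - 2 * c (k + 1) < p) (hc3 : c 0 < 3 * (p : ℤ))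
    (hlp : ∃ i₁ ∈ range 7, ∃ k ∈ range 7, i₁ ≠ k ∧ (p : ℤ) ≤ c (k + 1) ∧ (p : ℤ) ≤ c 0 - c (i₁ + 1) - c (k + 1)) :
    nonESum c p + (nden c p : ℤ) ≤ 6 := by
  have hp0 : (0 : ℤ) < p := by exact_mod_cast hp.pos
  obtain ⟨⟨-, hbox⟩, hhalf, -⟩ := id hc
  have hnn : ∀ k, k < 7 → 0 ≤ c (k + 1) ∧ 2 * c (k + 1) ≤ c 0 := fun k hk =>
    ⟨(hbox k (mem_range.2 hk)).1, hhalf k (mem_range.2 hk)⟩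
  obtain ⟨i₁, hi₁, k, hk, hik, hkp, hpair⟩ := hlp
  rw [mem_range] at hi₁ hk
  -- the block of `k` is short (`c_{k+1} ≥ p`, `c₀ < 3p`), so the block of `i₁` is long and `c_{i₁+1} < p`
  have hlong : (p : ℤ) < c 0 - 2 * c (i₁ + 1) := by linarith
  have hci : c (i₁ + 1) < p := by linarith
  -- hence every other block is short
  have hblk : ∀ k', k' < 7 → k' ≠ i₁ → c 0 - 2 * c (k' + 1) < (p : ℤ) := by
    intro k' hk' hne
    by_cases hk'i : k' = i
    · have hi₁i : i₁ ≠ i := fun h => hne (hk'i.trans h.symm)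
      have := hshort i₁ (mem_erase.2 ⟨hi₁i, mem_range.2 hi₁⟩)
      linarith
    · exact hshort k' (mem_erase.2 ⟨hk'i, mem_range.2 hk'⟩)
  -- termwise facts on the six non-`E` floors
  have hf1 : ∀ x ∈ nonE, pf c p x ≤ 1 := by
    intro x hx
    obtain ⟨hx1, hx2, hlt⟩ := nonE_bounds x hx
    obtain ⟨ha0, ha2⟩ := hnn x.1 hx1
    obtain ⟨hb0, hb2⟩ := hnn x.2 hx2
    have hform : c 0 - c (x.1 + 1) - c (x.2 + 1) < 2 * (p : ℤ) := by
      by_cases h1 : x.1 = i₁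
      · have := hblk x.2 hx2 (by omega); omega
      · have := hblk x.1 hx1 h1; omega
    have := (Int.ediv_lt_iff_lt_mul hp0).2 hform
    unfold pf; omega
  have hf0 : ∀ x ∈ nonE, ¬ (x.1 = i₁ ∨ x.2 = i₁) → pf c p x ≤ 0 := by
    intro x hx hxi
    rw [not_or] at hxi
    obtain ⟨hx1, hx2, hlt⟩ := nonE_bounds x hx
    have h1 := hblk x.1 hx1 hxi.1
    have h2 := hblk x.2 hx2 hxi.2
    obtain ⟨ha0, ha2⟩ := hnn x.1 hx1
    obtain ⟨hb0, hb2⟩ := hnn x.2 hx2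
    unfold pf
    rw [Int.ediv_eq_zero_of_lt (by omega) (by omega)]
  -- the non-`E` floors are carried by the (at most two) pairs through `i₁`
  have hsumA : nonESum c p ≤ ((nonE.filter fun x : ℕ × ℕ => x.1 = i₁ ∨ x.2 = i₁).card : ℤ) := by
    have hsplit := Finset.sum_filter_add_sum_filter_not nonE (fun x : ℕ × ℕ => x.1 = i₁ ∨ x.2 = i₁) (pf c p)
    unfold nonESum
    rw [← hsplit]
    have h1 := Finset.sum_le_card_nsmul (nonE.filter fun x : ℕ × ℕ => x.1 = i₁ ∨ x.2 = i₁) (pf c p) 1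
      fun x hx => hf1 x (mem_filter.1 hx).1
    have h2 : ∑ x ∈ nonE.filter (fun x : ℕ × ℕ => ¬ (x.1 = i₁ ∨ x.2 = i₁)), pf c p x ≤ 0 :=
      Finset.sum_nonpos fun x hx => hf0 x (mem_filter.1 hx).1 (mem_filter.1 hx).2
    simp only [nsmul_eq_mul, mul_one] at h1
    linarith
  -- the large denominator slots avoid `i₁`
  have hnden : nden c p ≤ (denSlots.erase i₁).card := by
    unfold nden
    apply card_le_card
    intro k' hk'
    rw [mem_filter] at hk'
    rw [mem_erase]
    refine ⟨?_, hk'.1⟩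
    rintro rfl
    linarith [hk'.2]
  have hsix : ((nonE.filter fun x : ℕ × ℕ => x.1 = i₁ ∨ x.2 = i₁).card : ℤ) + ((denSlots.erase i₁).card : ℤ) ≤ 6 := by
    exact_mod_cast path_six i₁ (mem_range.2 hi₁)
  have hnden' : (nden c p : ℤ) ≤ ((denSlots.erase i₁).card : ℤ) := by exact_mod_cast hnden
  linarith

/-- No large partner of the long slot and `c₀ < 3p` ⇒ (DISJ) as stated in `RVFlatGaugeCap`: a violating pair `(j,k)` with `j`
long would be a witness, and with `j` short the form is `< p` because `(c₀ − 2c_{j+1}) + (c₀ − 2c_{k+1}) < p + (c₀ − 2p) < 2p`. -/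
theorem disj_of_no_largePartner (c : ℕ → ℤ) {p : ℕ} (hc3 : c 0 < 3 * (p : ℤ))
    (hno : ¬ ∃ i₁ ∈ range 7, ∃ k ∈ range 7, i₁ ≠ k ∧ (p : ℤ) ≤ c 0 - 2 * c (i₁ + 1) ∧ (p : ℤ) ≤ c (k + 1) ∧
      (p : ℤ) ≤ c 0 - c (i₁ + 1) - c (k + 1)) :
    ∀ j ∈ range 7, ∀ k ∈ range 7, j ≠ k → (p : ℤ) ≤ c (k + 1) → c 0 - c (j + 1) - c (k + 1) < p := by
  intro j hj k hk hjk hkp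
  by_contra hge
  rw [not_lt] at hge
  by_cases hlong : (p : ℤ) ≤ c 0 - 2 * c (j + 1)
  · exact hno ⟨j, hj, k, hk, hjk, hlong, hkp, hge⟩
  · rw [not_le] at hlong
    linarith

/-! ### LEMMA A⁺⁺: the budget closes everywhere once the bonus is on the right -/

/-- **LEMMA A⁺⁺.**  One long block and `c₀ < 3p` ⇒ `−e_D♭(c) − v_p ρ(c) ≤ cv(c) + min(nbig, [LP] + [2p ≤ d])`. -/
theorem gauge_le_cvplus (c : ℕ → ℤ) {p : ℕ} (hc : InPolytope c) (hp : p.Prime) (hp5 : 5 ≤ p) {i : ℕ}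
    (hshort : ∀ k ∈ (range 7).erase i, c 0 - 2 * c (k + 1) < p) (hc3 : c 0 < 3 * (p : ℤ)) :
    -eDflat c p - padicValRat p (rhoB c) ≤ refund c p - pairFloors c p + lpBonus c p := by
  have hp0 : (0 : ℤ) < p := by exact_mod_cast hp.pos
  obtain ⟨a, T, L, ha0, ha2, hnon, hden, hnden, hT, hL5, hL2, hL0, hflat, hval, hpf, hrefund, ht0, ht2, hpath⟩ :=
    flatBudget c hc hp hp5 (win_of_lt_three_p hp5 hc3) hshort hc3
  have hbonus0 := lpBonus_nonneg c p
  have hlp0 := lpUnit_nonneg c p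
  have hlp1 := lpUnit_le_one c p
  -- the `d`-digit bookkeeping: `e = ⌊d/p⌋ − min(1,⌊d/p⌋) = [2p ≤ d]`
  have hdig : dOf c / (p : ℤ) - min 1 (dOf c / (p : ℤ)) = (if 2 * (p : ℤ) ≤ dOf c then 1 else 0) ∧
      ((2 * (p : ℤ) ≤ dOf c) ↔ dOf c / (p : ℤ) = 2) := by
    by_cases h2p : 2 * (p : ℤ) ≤ dOf c
    · have htd : dOf c / (p : ℤ) = 2 := by
        have := (Int.le_ediv_iff_mul_le hp0).2 (show 2 * (p : ℤ) ≤ dOf c from h2p)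
        omega
      rw [if_pos h2p, htd]; norm_num; exact h2p
    · have ht1 : dOf c / (p : ℤ) ≤ 1 := by
        have := (Int.ediv_lt_iff_lt_mul hp0).2 (show dOf c < 2 * (p : ℤ) by omega)
        omega
      rw [if_neg h2p, min_eq_right ht1]; simp only [sub_self, true_and]
      constructor
      · intro h; exact absurd h h2p
      · intro h; omega
  obtain ⟨hdig, h2iff⟩ := hdig
  -- reduce the goal to the unit inequality `nonESum + denSum + e ≤ T + L + bonus`
  rw [hflat, hval, hrefund, hpf]
  set q := dOf c / (p : ℤ) with hq
  set e : ℤ := (if 2 * (p : ℤ) ≤ dOf c then 1 else 0) with he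
  have he0 : 0 ≤ e := by rw [he]; split_ifs <;> norm_num
  have he1 : e ≤ 1 := by rw [he]; split_ifs <;> norm_num
  have hLe : e ≤ L := by
    rw [he]; split_ifs with h
    · exact hL2 h
    · exact hL0
  suffices key : nonESum c p + denSum c p + e ≤ T + L + lpBonus c p by linarith
  by_cases h4 : a + (nbig c p : ℤ) ≤ 4
  · -- capacity: `T ≥ a + nbig ≥ nonESum + denSum`, and `e ≤ L`
    have hT' : a + (nbig c p : ℤ) ≤ T := by rw [min_eq_right h4] at hT; exact hT
    linarith
  · -- `a + nbig ≥ 5`: `T ≥ 4`, `L ≥ 1`, `nbig ≥ 3`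
    have hT' : (4 : ℤ) ≤ T := by rw [min_eq_left (by linarith)] at hT; exact hT
    have hL1 := hL5 (by linarith)
    have hn3 : (3 : ℤ) ≤ nbig c p := by linarith
    have hbon : lpBonus c p = lpUnit c p + e := by
      unfold lpBonus; rw [← he]; exact min_eq_right (by linarith)
    by_cases hlp : ∃ i₁ ∈ range 7, ∃ k ∈ range 7, i₁ ≠ k ∧ (p : ℤ) ≤ c 0 - 2 * c (i₁ + 1) ∧ (p : ℤ) ≤ c (k + 1) ∧
        (p : ℤ) ≤ c 0 - c (i₁ + 1) - c (k + 1)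
    · -- a large partner of the long slot: `[LP] = 1`, and the charge is at most six
      have hu : lpUnit c p = 1 := by unfold lpUnit; rw [if_pos hlp]
      obtain ⟨i₁, hi₁, k, hk, hik, -, hkp, hpair⟩ := hlp
      have h6 := nonESum_add_nden_le_six c hc hp hshort hc3 ⟨i₁, hi₁, k, hk, hik, hkp, hpair⟩
      rw [hbon, hu]
      linarith
    · -- no large partner: (DISJ) holds, the path budget caps the charge at five
      have hu : lpUnit c p = 0 := by unfold lpUnit; rw [if_neg hlp]
      have h5 := hpath (disj_of_no_largePartner c hc3 hlp)
      rw [hbon, hu]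
      linarith

end Cap

open Cap

/-! ### The conjecture node and the reduction -/

/-- **(CV⁺), OBSERVED — the large-parameter class law** (minted by this cell from exact computation; NOT a published result;
0 violations in 18,038 exhaustive deep instances `b₀ ≤ 22` and in a random sample up to `b₀ = 120`; tight in 89 % (98 % below
`b₀ < 3p`); equal to the PROVED class law `casoratianLaw_of_noMultipole` when all `b_k < p`).  For `b`, `b + e_j` in the polytope, `p ≥ 5` prime,
`b₀ + 2 < p²`, at most one long block, `C_j(b) ≠ 0`:
`v_p C_j(b) ≥ min(1,⌊d/p⌋) − N_p(b) + min(nbig, [LP] + [2p ≤ d])`. -/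
@[conjecture] def LargeParamClassLaw : Prop :=
  ∀ (b : ℕ → ℤ) (j p i : ℕ), InPolytope b → 1 ≤ j → j ≤ 7 → InPolytope (shift b j) → p.Prime → 5 ≤ p →
    (b 0 + 2 : ℤ) < (p : ℤ) ^ 2 → (∀ k ∈ (range 7).erase i, b 0 - 2 * b (k + 1) < p) → casoratian b j ≠ 0 →
    refund b p - pairFloors b p + lpBonus b p ≤ padicValRat p (casoratian b j)

/-- (CV⁺) restricted to gen-7's window (all `b_k < p`) is the tree's PROVED class law. -/
theorem largeParamClassLaw_of_small (b : ℕ → ℤ) {j p i : ℕ} (hb : InPolytope b) (hj1 : 1 ≤ j) (hj7 : j ≤ 7)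
    (hb' : InPolytope (shift b j)) (hp : p.Prime) (hp5 : 5 ≤ p) (hwin : (b 0 + 2 : ℤ) < (p : ℤ) ^ 2)
    (hshort : ∀ k ∈ (range 7).erase i, b 0 - 2 * b (k + 1) < p) (hsmall : ∀ k ∈ range 7, b (k + 1) < p)
    (hcas : casoratian b j ≠ 0) :
    refund b p - pairFloors b p + lpBonus b p ≤ padicValRat p (casoratian b j) := by
  haveI : Fact p.Prime := ⟨hp⟩
  rw [lpBonus_eq_zero_of_small hsmall, add_zero]
  exact ClusterValuation.casoratianLaw_of_noMultipole b hb hj1 hj7 hb' hp5 hwin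
    (fun x _ => ClusterValuation.classPoleCount_le_one_of_short_blocks b hb hp.pos hshort x) hcas

/-- **REDUCTION (PROVED): (CV⁺) ⇒ the flat `S₇`-gauge law for ALL 5040 labellings on the WHOLE region {at most one long
block, `b₀ < 3p`, `p ≥ 5`}** — LEMMA A⁺⁺ transported along `σ` (`Cap.flat_of_perm28`; every hypothesis is
`S₇`-invariant). -/
theorem flatGaugeLaw_of_largeParamClassLaw (hCV : LargeParamClassLaw) (b : ℕ → ℤ) {j p : ℕ}
    (σ : Equiv.Perm (Fin 7)) (hb : InPolytope b) (hj1 : 1 ≤ j) (hj7 : j ≤ 7) (hb' : InPolytope (shift b j))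
    (hp : p.Prime) (hp5 : 5 ≤ p) {i : ℕ} (hshort : ∀ k ∈ (range 7).erase i, b 0 - 2 * b (k + 1) < p)
    (hb3 : b 0 < 3 * (p : ℤ)) (hcas : casoratian b j ≠ 0) :
    -eDflat b p - padicValRat p (rhoB (permLower σ b)) ≤ padicValRat p (casoratian b j) := by
  obtain ⟨i', hshort'⟩ := short_permLower σ hshort
  have hb3' : permLower σ b 0 < 3 * (p : ℤ) := by rw [permLower_zero]; exact hb3
  have hwin' : (permLower σ b 0 + 2 : ℤ) < (p : ℤ) ^ 2 := win_of_lt_three_p hp5 hb3'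
  exact flat_of_perm28 b σ hj1 hj7 hb' hcas fun j' hj1' hj7' hshift hne =>
    (gauge_le_cvplus (permLower σ b) (inPolytope_permLower σ hb) hp hp5 hshort' hb3').trans
      (hCV (permLower σ b) j' p i' (inPolytope_permLower σ hb) hj1' hj7' hshift hp hp5 hwin' hshort' hne)

/-- **The flat `S₇`-gauge law on frontier (F1)** — at most one long block and `b₀ < 3p` (this contains the capacity and
disjoint regions of THEOREM W⁺ and gen-7's window below `3p`).  OBSERVED; by `flatGaugeLawF1_of_largeParamClassLaw` it is
implied by (CV⁺). -/
@[conjecture] def FlatGaugeLawF1 : Prop :=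
  ∀ (b : ℕ → ℤ) (j p i : ℕ) (σ : Equiv.Perm (Fin 7)), InPolytope b → 1 ≤ j → j ≤ 7 → InPolytope (shift b j) →
    p.Prime → 5 ≤ p → (∀ k ∈ (range 7).erase i, b 0 - 2 * b (k + 1) < p) → b 0 < 3 * (p : ℤ) →
    casoratian b j ≠ 0 → -eDflat b p - padicValRat p (rhoB (permLower σ b)) ≤ padicValRat p (casoratian b j)

/-- (CV⁺) ⇒ FLAT on (F1). -/
theorem flatGaugeLawF1_of_largeParamClassLaw (h : LargeParamClassLaw) : FlatGaugeLawF1 :=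
  fun b _ _ _ σ hb hj1 hj7 hb' hp hp5 hshort hb3 hcas =>
    flatGaugeLaw_of_largeParamClassLaw h b σ hb hj1 hj7 hb' hp hp5 hshort hb3 hcas

/-- The trivial edge `FlatGaugeLaw ⇒ FlatGaugeLawF1` (`m₁ ≤ b₀ + 1 < p²`). -/
theorem flatGaugeLawF1_of_flatGaugeLaw (h : FlatGaugeLaw) : FlatGaugeLawF1 := by
  intro b j p i σ hb hj1 hj7 hb' hp hp5 _ hb3 hcas
  have hwin := win_of_lt_three_p hp5 hb3
  exact h b j p σ hb hj1 hj7 hb' hp hp5 (by have := Window.m1_le_b0_add_one hb; linarith) hcas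

/-- FLAT on (F1) contains THEOREM W⁺ (DISJ) (whose hypotheses include `b₀ < 3p`) — consistency of the nodes. -/
theorem flatGaugeLawDisj_of_F1 (h : FlatGaugeLawF1) : FlatGaugeLawDisj :=
  fun b j p i σ hb hj1 hj7 hb' hp hp5 hshort hb3 _ _ hcas => h b j p i σ hb hj1 hj7 hb' hp hp5 hshort hb3 hcas

/-- FLAT on (F1) contains THEOREM W⁺ (CAP) (`nbig ≤ 3` and one long block force `b₀ < 3p`). -/
theorem flatGaugeLawCap_of_F1 (h : FlatGaugeLawF1) : FlatGaugeLawCap := by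
  intro b j p i σ hb hj1 hj7 hb' hp hp5 hshort hcap hcas
  have hind : (0 : ℤ) ≤ (if 2 * (p : ℤ) ≤ dOf b then 1 else 0) := by split_ifs <;> norm_num
  have h5 : nbig b p ≤ 5 := by exact_mod_cast (show (nbig b p : ℤ) ≤ 5 by linarith)
  exact h b j p i σ hb hj1 hj7 hb' hp hp5 hshort (b0_lt_three_p hshort h5) hcas

/-! ### Kernel instances of the bonus -/

/-- A frontier-(F1) instance: `b = (12;6,6,5,5,5,5,0)`, `p = 5` — six lower parameters `≥ p`, all of them partners of
the long slot in a large pair form (`12 − 0 − 5 = 7 ≥ 5`), `d = 4 < 2p`: bonus `= min(6, 1 + 0) = 1` (the exact values here: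
`v_5 C_j = −5 = cv + 1` for every admissible `j = 3,…,7`, and the flat gauge bound is `−5` too — tight, and above `cv = −6`).
And a window instance (`nbig = 0`): bonus `0`. -/
example :
    let b : ℕ → ℤ := fun k => (([12, 6, 6, 5, 5, 5, 5, 0] : List ℤ)).getD k 0
    let w : ℕ → ℤ := fun k => (([12, 4, 4, 4, 4, 4, 4, 0] : List ℤ)).getD k 0
    nbig b 5 = 6 ∧ dOf b = 4 ∧ lpUnit b 5 = 1 ∧ lpBonus b 5 = 1 ∧ nbig w 5 = 0 ∧ lpBonus w 5 = 0 := by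
  decide

end Summit.KontsevichZagierPeriods.Zeta5Search.RVFlatGauge
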